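import Mathlib
import Summits.NavierStokesRegularity.NavierStokesRegularity.Theorems.EulerZoomLiouvillePowerGaugeEulerLiouvilleCondenserShellCondenser

/-!
# (B″_A) THE SLICE-WISE SHELL CONDENSER — amplitude-function form of (B″) (nsreg-p2 g36 ROUND-46 v1.2 §10, plate t49-B″_A,
`r46/Sketch46c.lean` sha16 38864b14c537bdca; referee F6 of SCORE-p2-ROUND-46-0828)

Width piece for crux `EulerZoomLiouville.PowerGaugeEulerLiouville` (stmt-NavierStokesRegularity-19832), by name under LEAD 19832
(ns-typeII-p2 g13); seat ns-sfl-p1 g7, `--supports stmt-NavierStokesRegularity-19832 --as helper`.  Texts = nsreg-p2 g36's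
`NsregP2.R46c.SlicewiseShellCondenser` and `NsregP2.R46c.TopIsWorstExceptionalSet` binder-for-binder (`E3` spelled out).

Setting of (B″) `Condenser.shellCondenser_of` (p678940) verbatim, but the crossing at height `s` has amplitude `A s ≥ γ s` for an
ARBITRARY height-dependent `A`, and the conclusion keeps the heights' individual amplitudes: for the exceptional (non-quiet) set
`N = {s | X/(η(ℓ₂−ℓ₁)) ≤ ∫ 𝟙_{B(0,R')}‖V∘Rot⁻¹‖² ∘ plane s}` of heights, of measure `≤ η(ℓ₂−ℓ₁)` in the window (Markov),
`2π(1−2δ)² ∫_{[ℓ₁,ℓ₂] \ N} A(s)² ds ≤ log(G·r/(δγℓ₁)) · S`.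
Proof: per quiet height the core (C) `Condenser.circleMeanCondenserCore_of` on the slice disc with amplitude `A s` (gap
`(1−δ)A s − B ≥ (1−2δ)A s` since `B ≤ δγℓ₁ ≤ δ A s`; prefactor `δ A s/r ≥ δγℓ₁/r`, so `G r/(δγℓ₁) ≥ 1` and the logarithm is
`≥ 0`) gives `2π(1−2δ)²A(s)² ≤ log(G r/(δγℓ₁)) · E_s` with `E_s` the slab slice energy at height `s` (`slicewise_height_bound`; a
vanishing `E_s` is excluded by the core itself applied with small budgets); then `MeasureTheory.integral_mono_of_nonneg` against the
(integrable) slice-energy function — NO measurability of `A` is needed, a non-integrable `A²` has Bochner integral `0 ≤` the right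
side — and Fubini over the slab (`Condenser.integral_integral_indicator_ballSlab_plane`, p678007).
`TopIsWorstExceptionalSet` is the bathtub rearrangement `Condenser.setIntegral_sq_ge_bathtub` (p669481): (B″_A) with `A s = γ s`
gives back (B″).

HONEST FRAMING: real analysis in `ℝ³`; nothing here proves the crux E (19832 OPEN), any door Target, or any Navier–Stokes
statement; no summit statement is touched. [folklore (length–area method); cite: ConstantinIgnatovaVicol2026Putative, §3.4.1
for the setting]
-/

noncomputable section

open Set Filter Topology Metric Function MeasureTheory Real
open scoped RealInnerProductSpace ENNReal

set_option linter.dupNamespace false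

namespace Summit.NavierStokesRegularity.NavierStokesRegularity.Theorems.PowerGaugeEulerLiouville.Condenser

open Literature.Analysis Literature.Analysis.FluidPDE

/-! ## The bookkeeping plate -/

/-- **`NsregP2.R46c.TopIsWorstExceptionalSet`, binder-for-binder**: removing from the window `[ℓ₁, ℓ₂]` a measurable set of
heights of measure `≤ η(ℓ₂−ℓ₁)` leaves `∫ s² ≥ ((ℓ₁+(1−η)(ℓ₂−ℓ₁))³ − ℓ₁³)/3` (the worst exceptional set is the top of the
window; bathtub `Condenser.setIntegral_sq_ge_bathtub`). [folklore (bathtub principle)] -/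
theorem topIsWorstExceptionalSet :
    ∀ (ℓ₁ ℓ₂ η : ℝ) (N : Set ℝ), 0 < ℓ₁ → ℓ₁ < ℓ₂ → 0 < η → η < 1 → MeasurableSet N →
      volume (N ∩ Icc ℓ₁ ℓ₂) ≤ ENNReal.ofReal (η * (ℓ₂ - ℓ₁)) →
        ((ℓ₁ + (1 - η) * (ℓ₂ - ℓ₁)) ^ 3 - ℓ₁ ^ 3) / 3 ≤ ∫ s in Icc ℓ₁ ℓ₂ \ N, s ^ 2 := by
  intro ℓ₁ ℓ₂ η N hℓ₁ hℓ hη hη1 hN hvol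
  set μ₀ : ℝ := (1 - η) * (ℓ₂ - ℓ₁) with hμ₀
  have hμ₀pos : 0 < μ₀ := by rw [hμ₀]; exact mul_pos (by linarith) (by linarith)
  have hJm : MeasurableSet (Icc ℓ₁ ℓ₂) := measurableSet_Icc
  have hJfin : volume (Icc ℓ₁ ℓ₂) ≠ ⊤ := measure_Icc_lt_top.ne
  have hSm : MeasurableSet (Icc ℓ₁ ℓ₂ \ N) := hJm.diff hN
  -- the good set has measure `≥ μ₀`
  have hNreal : volume.real (Icc ℓ₁ ℓ₂ ∩ N) ≤ η * (ℓ₂ - ℓ₁) := by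
    rw [inter_comm, measureReal_def]
    have h := ENNReal.toReal_mono ENNReal.ofReal_ne_top hvol
    rwa [ENNReal.toReal_ofReal (by nlinarith)] at h
  have hSvol : μ₀ ≤ volume.real (Icc ℓ₁ ℓ₂ \ N) := by
    have hsplit := measureReal_inter_add_sdiff (μ := volume) (s := Icc ℓ₁ ℓ₂) (t := N) hN hJfin
    rw [Real.volume_real_Icc_of_le hℓ.le] at hsplit
    rw [hμ₀]
    nlinarith
  have hbath := setIntegral_sq_ge_bathtub hℓ₁.le hμ₀pos.le hSm sdiff_subset hSvol
  have hIcc : ∫ s in Icc ℓ₁ (ℓ₁ + μ₀), s ^ 2 = ((ℓ₁ + μ₀) ^ 3 - ℓ₁ ^ 3) / 3 := by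
    rw [integral_Icc_eq_integral_Ioc, ← intervalIntegral.integral_of_le (by linarith), integral_pow]; norm_num
  rw [hIcc, hμ₀] at hbath
  exact hbath

/-! ## The per-height bound -/

/-- **Per-height bound of the slice-wise condenser.**  `W ∈ C¹(ℝ³,ℝ³)`, a point `y` of the coordinate plane `{x₂ = y 2}` with
`‖W y‖ ≥ m ≥ m₀ > 0`, a disc radius `r` with `‖y‖ + r < R'`, `‖DW‖ ≤ G` on `B(0,R')`, slice budgets `∫𝟙_{B(0,R')}‖W‖²∘plane ≤ t_F`,
`∫𝟙_{B(0,R')}‖DW‖²∘plane ≤ E_s` at the height `y 2`, and smallness `√(2t_F/π)/r ≤ δ m₀`, `δ < 1/2`:  then `δm₀/r ≤ G` and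
`2π((1−2δ)m)² ≤ log(G r/(δ m₀)) · E_s`.  [the core `Condenser.circleMeanCondenserCore_of` through the `ℂ`-chart; a zero budget
`E_s` is excluded by the core applied with the budgets `ε ↓ 0`; folklore (length–area method)] -/
theorem slicewise_height_bound {W : EuclideanSpace ℝ (Fin 3) → EuclideanSpace ℝ (Fin 3)} (hWc : ContDiff ℝ 1 W)
    {y : EuclideanSpace ℝ (Fin 3)} {m m₀ r R' δ tF Es G : ℝ} (hm₀ : 0 < m₀) (hm₀m : m₀ ≤ m) (hWy : m ≤ ‖W y‖)
    (hr : 0 < r) (hfit : ‖y‖ + r < R') (hδ : 0 < δ) (hδ2 : δ < 1 / 2)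
    (hG : ∀ z ∈ ball (0 : EuclideanSpace ℝ (Fin 3)) R', ‖fderiv ℝ W z‖ ≤ G)
    (hFs : ∫ a, (ball (0 : EuclideanSpace ℝ (Fin 3)) R').indicator (fun x => ‖W x‖ ^ 2) (plane (y 2) a) ≤ tF)
    (hGs : ∫ a, (ball (0 : EuclideanSpace ℝ (Fin 3)) R').indicator (fun x => ‖fderiv ℝ W x‖ ^ 2) (plane (y 2) a) ≤ Es)
    (hB : Real.sqrt (2 * tF / Real.pi) / r ≤ δ * m₀) :
    δ * m₀ / r ≤ G ∧ 2 * Real.pi * ((1 - 2 * δ) * m) ^ 2 ≤ Real.log (G * r / (δ * m₀)) * Es := by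
  have hm : 0 < m := hm₀.trans_le hm₀m
  have hWd : Differentiable ℝ W := hWc.differentiable one_ne_zero
  have hWy0 : 0 < ‖W y‖ := hm.trans_le hWy
  -- the unit vector `u = W y / ‖W y‖` and the scalar through the `ℂ`-chart at `y`
  set u : EuclideanSpace ℝ (Fin 3) := (‖W y‖⁻¹ : ℝ) • W y with hu
  have hu1 : ‖u‖ = 1 := by
    rw [hu, norm_smul, norm_inv, norm_norm, inv_mul_cancel₀ hWy0.ne']
  set ψ : ℂ → ℝ := fun z =>
    ⟪W (y + z.re • EuclideanSpace.basisFun (Fin 3) ℝ 0 + z.im • EuclideanSpace.basisFun (Fin 3) ℝ 1), u⟫ with hψ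
  have hψc : ContDiff ℝ 1 ψ := contDiff_comp_cchart (f := fun x => ⟪W x, u⟫) (hWc.inner ℝ contDiff_const) y
  have hψ0 : m ≤ ψ 0 := by
    have h0 : ψ 0 = ‖W y‖ := by
      simp only [hψ, Complex.zero_re, Complex.zero_im, zero_smul, add_zero]
      rw [hu]; exact inner_self_normalize _
    rw [h0]; exact hWy
  have hGψ : ∀ z ∈ closedBall (0 : ℂ) r, ‖fderiv ℝ ψ z‖ ≤ G := by
    intro z hz
    refine (norm_fderiv_inner_comp_cchart_le hWd hu1.le y z).trans (hG _ ?_)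
    rw [mem_ball, dist_zero_right]
    rw [mem_closedBall, dist_zero_right] at hz
    exact (norm_cchart_le y z).trans_lt (by linarith)
  have hAψ : ∫ z in closedBall (0 : ℂ) r, ψ z ^ 2 ≤ tF := (setIntegral_cdisc_sq_inner_le hWc hu1.le hfit).trans hFs
  have hEψ : ∫ z in closedBall (0 : ℂ) r, ‖fderiv ℝ ψ z‖ ^ 2 ≤ Es :=
    (setIntegral_cdisc_sq_norm_fderiv_inner_le hWc hu1.le hfit).trans hGs
  -- the core with any positive budget `E' ≥ E_s`; the small-drop branch is impossible since `δ < 1/2`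
  set B : ℝ := Real.sqrt (2 * tF / Real.pi) / r with hBdef
  have hBm : B ≤ δ * m := hB.trans (mul_le_mul_of_nonneg_left hm₀m hδ.le)
  have hcoreE : ∀ E' : ℝ, 0 < E' → Es ≤ E' →
      δ * m / r * Real.exp (2 * Real.pi * ((1 - δ) * m - B) ^ 2 / E') ≤ G := by
    intro E' hE' hEsE'
    rcases circleMeanCondenserCore_of hψc hm hψ0 hr hδ hE' hGψ hAψ (hEψ.trans hEsE') with h | h
    · exfalso; nlinarith
    · exact h
  -- the prefactor alone: `δ m₀ / r ≤ δ m / r ≤ G`, so the logarithm is `≥ 0`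
  have hEs0 : 0 ≤ Es := le_trans (integral_nonneg fun _ => Set.indicator_nonneg (fun x _ => sq_nonneg _) _) hGs
  have hpre0 : 0 < δ * m / r := by positivity
  have hpre : δ * m₀ / r ≤ δ * m / r := div_le_div_of_nonneg_right (mul_le_mul_of_nonneg_left hm₀m hδ.le) hr.le
  have hGge : δ * m / r ≤ G := by
    have h := hcoreE (Es + 1) (by linarith) (by linarith)
    have h1 : δ * m / r ≤ δ * m / r * Real.exp (2 * Real.pi * ((1 - δ) * m - B) ^ 2 / (Es + 1)) :=
      le_mul_of_one_le_right hpre0.le (Real.one_le_exp (by positivity))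
    exact h1.trans h
  have hG0 : 0 < G := hpre0.trans_le hGge
  have hratio : 1 ≤ G * r / (δ * m₀) := by
    rw [le_div_iff₀ (by positivity)]
    have := (div_le_iff₀ hr).1 (hpre.trans hGge)
    linarith
  have hL0 : 0 ≤ Real.log (G * r / (δ * m₀)) := Real.log_nonneg hratio
  refine ⟨hpre.trans hGge, ?_⟩
  -- from a positive budget `E' ≥ E_s`: `2π((1−2δ)m)² ≤ log(G r/(δ m₀)) · E'`
  have hlow0 : 0 ≤ (1 - 2 * δ) * m := mul_nonneg (by linarith) hm.le
  have hlow : (1 - 2 * δ) * m ≤ (1 - δ) * m - B := by linarith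
  have hsq : ((1 - 2 * δ) * m) ^ 2 ≤ ((1 - δ) * m - B) ^ 2 := pow_le_pow_left₀ hlow0 hlow 2
  have hboundE : ∀ E' : ℝ, 0 < E' → Es ≤ E' →
      2 * Real.pi * ((1 - 2 * δ) * m) ^ 2 ≤ Real.log (G * r / (δ * m₀)) * E' := by
    intro E' hE' hEsE'
    have h := hcoreE E' hE' hEsE'
    -- `exp(Q/E') ≤ G r/(δ m) ≤ G r/(δ m₀)`
    have h1 : Real.exp (2 * Real.pi * ((1 - δ) * m - B) ^ 2 / E') ≤ G * r / (δ * m₀) := by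
      rw [le_div_iff₀ (by positivity)]
      have h3 : δ * m / r * Real.exp (2 * Real.pi * ((1 - δ) * m - B) ^ 2 / E') * r ≤ G * r :=
        mul_le_mul_of_nonneg_right h hr.le
      have h4 : δ * m / r * Real.exp (2 * Real.pi * ((1 - δ) * m - B) ^ 2 / E') * r =
          Real.exp (2 * Real.pi * ((1 - δ) * m - B) ^ 2 / E') * (δ * m) := by
        field_simp
      rw [h4] at h3
      have h5 : Real.exp (2 * Real.pi * ((1 - δ) * m - B) ^ 2 / E') * (δ * m₀) ≤
          Real.exp (2 * Real.pi * ((1 - δ) * m - B) ^ 2 / E') * (δ * m) :=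
        mul_le_mul_of_nonneg_left (mul_le_mul_of_nonneg_left hm₀m hδ.le) (Real.exp_pos _).le
      exact h5.trans h3
    have h6 : 2 * Real.pi * ((1 - δ) * m - B) ^ 2 / E' ≤ Real.log (G * r / (δ * m₀)) := by
      rw [← Real.exp_le_exp, Real.exp_log (by positivity)]
      exact h1
    rw [div_le_iff₀ hE'] at h6
    exact (mul_le_mul_of_nonneg_left hsq (by positivity)).trans h6
  -- `E_s > 0`: otherwise the bound with small budgets contradicts `m > 0`
  have hQ0 : 0 < 2 * Real.pi * ((1 - 2 * δ) * m) ^ 2 := by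
    have : 0 < (1 - 2 * δ) * m := mul_pos (by linarith) hm
    positivity
  rcases hEs0.lt_or_eq with hEspos | hEs00
  · exact hboundE Es hEspos le_rfl
  · exfalso
    set L : ℝ := Real.log (G * r / (δ * m₀)) with hLdef
    set Q : ℝ := 2 * Real.pi * ((1 - 2 * δ) * m) ^ 2 with hQdef
    have hε : 0 < Q / (2 * (L + 1)) := by positivity
    have h := hboundE (Q / (2 * (L + 1))) hε (by rw [← hEs00]; exact hε.le)
    have h7 : L * (Q / (2 * (L + 1))) ≤ Q / 2 := by
      rw [mul_div_assoc', div_le_div_iff₀ (by positivity) (by positivity)]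
      nlinarith
    linarith

/-! ## The slice-wise shell condenser -/

/-- **(B″_A) `NsregP2.R46c.SlicewiseShellCondenser`, binder-for-binder** (Sketch46c of nsreg-p2 g36, sha16 38864b14c537bdca,
plate t49-B″_A; `E3` spelled out).  See the module docstring.  [folklore (length–area method);
cite: ConstantinIgnatovaVicol2026Putative, §3.4.1 for the setting] -/
theorem slicewiseShellCondenser :
    ∀ (V : EuclideanSpace ℝ (Fin 3) → EuclideanSpace ℝ (Fin 3)), ContDiff ℝ 1 V →
      ∀ (e : EuclideanSpace ℝ (Fin 3)), ‖e‖ = 1 →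
        ∀ (γ ℓ₁ ℓ₂ r R' η δ X S G : ℝ) (A : ℝ → ℝ), 0 < γ → 0 < ℓ₁ → ℓ₁ < ℓ₂ → 0 < r → ℓ₂ + r < R' → 0 < η → η < 1 →
          0 < δ → δ < 1 / 2 → 0 < X → 0 < S →
          (∫ x in ball (0 : EuclideanSpace ℝ (Fin 3)) R', ‖V x‖ ^ 2 ≤ X) →
          (∫ x in ball (0 : EuclideanSpace ℝ (Fin 3)) R' ∩ {x : EuclideanSpace ℝ (Fin 3) | ℓ₁ ≤ ‖x‖},
              ‖fderiv ℝ V x‖ ^ 2 ≤ S) →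
          (∀ z ∈ ball (0 : EuclideanSpace ℝ (Fin 3)) R', ‖fderiv ℝ V z‖ ≤ G) →
          Real.sqrt (2 * (X / (η * (ℓ₂ - ℓ₁))) / Real.pi) / r ≤ δ * (γ * ℓ₁) →
          (∀ s ∈ Icc ℓ₁ ℓ₂, γ * s ≤ A s) →
          (∀ s ∈ Icc ℓ₁ ℓ₂, ∃ y₁ : EuclideanSpace ℝ (Fin 3), ⟪y₁, e⟫ = s ∧ ‖y₁‖ ≤ ℓ₂ ∧ A s ≤ ‖V y₁‖) →
          ∃ N : Set ℝ, volume (N ∩ Icc ℓ₁ ℓ₂) ≤ ENNReal.ofReal (η * (ℓ₂ - ℓ₁)) ∧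
            2 * Real.pi * (1 - 2 * δ) ^ 2 * (∫ s in Icc ℓ₁ ℓ₂ \ N, A s ^ 2) ≤
              Real.log (G * r / (δ * (γ * ℓ₁))) * S := by
  intro V hV e he γ ℓ₁ ℓ₂ r R' η δ X S G A hγ hℓ₁ hℓ hr hR' hη hη1 hδ hδ2 hX hS hAX hE hG hsmall hAs hcross
  -- rotate `e` to `e₂`
  set e₂ : EuclideanSpace ℝ (Fin 3) := EuclideanSpace.basisFun (Fin 3) ℝ 2 with he₂
  have he₂1 : ‖e₂‖ = 1 := (EuclideanSpace.basisFun (Fin 3) ℝ).orthonormal.1 2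
  obtain ⟨Rot, hRot⟩ := exists_linearIsometryEquiv_apply_eq he he₂1
  set W : EuclideanSpace ℝ (Fin 3) → EuclideanSpace ℝ (Fin 3) := fun z => V (Rot.symm z) with hW
  have hWc : ContDiff ℝ 1 W := hV.comp Rot.symm.toContinuousLinearEquiv.contDiff
  have hDW : ∀ x, ‖fderiv ℝ W x‖ = ‖fderiv ℝ V (Rot.symm x)‖ := norm_fderiv_comp_linearIsometryEquiv V Rot
  have hWn : Continuous fun x => ‖W x‖ ^ 2 := hWc.continuous.norm.pow 2
  have hDWc : Continuous fun x => ‖fderiv ℝ W x‖ ^ 2 := ((hWc.continuous_fderiv one_ne_zero).norm.pow 2)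
  -- budgets for `W`
  have hA' : ∫ x in ball (0 : EuclideanSpace ℝ (Fin 3)) R', ‖W x‖ ^ 2 ≤ X := by
    have h := setIntegral_ball_comp_linearIsometryEquiv (fun x => ‖V x‖ ^ 2) Rot R'
    simp only [hW]
    rw [h]; exact hAX
  have hE' : ∫ x in ball (0 : EuclideanSpace ℝ (Fin 3)) R' ∩ {x | ℓ₁ ≤ ‖x‖}, ‖fderiv ℝ W x‖ ^ 2 ≤ S := by
    have h := setIntegral_ballShell_comp_linearIsometryEquiv (fun x => ‖fderiv ℝ V x‖ ^ 2) Rot R' ℓ₁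
    simp_rw [hDW]
    rw [h]; exact hE
  have hEslab : ∫ x in ball (0 : EuclideanSpace ℝ (Fin 3)) R' ∩ {x | ℓ₁ ≤ x 2}, ‖fderiv ℝ W x‖ ^ 2 ≤ S :=
    (setIntegral_ballSlab_le_ballShell hDWc (fun x => sq_nonneg _) R' ℓ₁).trans hE'
  have hGW : ∀ z ∈ ball (0 : EuclideanSpace ℝ (Fin 3)) R', ‖fderiv ℝ W z‖ ≤ G := by
    intro z hz
    rw [hDW]
    apply hG
    rwa [mem_ball, dist_zero_right, Rot.symm.norm_map, ← dist_zero_right, ← mem_ball]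
  -- the slice functions
  set hF : ℝ → ℝ := fun s => ∫ a, (ball (0 : EuclideanSpace ℝ (Fin 3)) R').indicator (fun x => ‖W x‖ ^ 2) (plane s a)
    with hhF
  set hGs : ℝ → ℝ := fun s =>
    ∫ a, (ball (0 : EuclideanSpace ℝ (Fin 3)) R' ∩ {x | ℓ₁ ≤ x 2}).indicator (fun x => ‖fderiv ℝ W x‖ ^ 2) (plane s a)
    with hhGs
  have hFint : Integrable hF := integrable_integral_plane _ (integrable_indicator_ball_of_continuous hWn R')
  have hGsint : Integrable hGs := integrable_integral_plane _ (integrable_indicator_ballSlab_of_continuous hDWc R' ℓ₁)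
  have hFnn : ∀ s, 0 ≤ hF s := fun s => integral_indicator_plane_nonneg (fun x => sq_nonneg _) R' s
  have hGsnn : ∀ s, 0 ≤ hGs s := fun s => integral_indicator_ballSlab_plane_nonneg (fun x => sq_nonneg _) R' ℓ₁ s
  have hFtot : ∫ s, hF s ≤ X := by rw [hhF, integral_integral_indicator_plane hWn R']; exact hA'
  have hGstot : ∫ s, hGs s ≤ S := by rw [hhGs, integral_integral_indicator_ballSlab_plane hDWc R' ℓ₁]; exact hEslab
  have hGs_eq : ∀ s, ℓ₁ ≤ s → hGs s =
      ∫ a, (ball (0 : EuclideanSpace ℝ (Fin 3)) R').indicator (fun x => ‖fderiv ℝ W x‖ ^ 2) (plane s a) := by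
    intro s hs
    simp only [hhGs]
    exact integral_congr_ae (ae_of_all _ fun a => indicator_ballSlab_plane_of_le hs a)
  -- measurability of `hF`
  have hFm : Measurable hF := by
    have hH : Measurable ((ball (0 : EuclideanSpace ℝ (Fin 3)) R').indicator fun x => ‖W x‖ ^ 2) :=
      hWn.measurable.indicator measurableSet_ball
    have h1 : StronglyMeasurable (uncurry fun (s : ℝ) (a : EuclideanSpace ℝ (Fin 2)) =>
        (ball (0 : EuclideanSpace ℝ (Fin 3)) R').indicator (fun x => ‖W x‖ ^ 2) (plane s a)) := by
      have e1 : (uncurry fun (s : ℝ) (a : EuclideanSpace ℝ (Fin 2)) =>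
          (ball (0 : EuclideanSpace ℝ (Fin 3)) R').indicator (fun x => ‖W x‖ ^ 2) (plane s a)) =
          fun p => (ball (0 : EuclideanSpace ℝ (Fin 3)) R').indicator (fun x => ‖W x‖ ^ 2) (planeEquiv.symm p) := by
        funext p; rw [uncurry, ← planeEquiv_symm_apply]
      rw [e1]; exact (hH.comp planeEquiv.symm.measurable).stronglyMeasurable
    exact (h1.integral_prod_right (ν := volume)).measurable
  -- the exceptional set: Markov for `hF` on the window
  set tF : ℝ := X / (η * (ℓ₂ - ℓ₁)) with htF
  have hℓ21 : 0 < ℓ₂ - ℓ₁ := by linarith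
  have htFpos : 0 < tF := by rw [htF]; positivity
  set N : Set ℝ := {s | tF ≤ hF s} with hNdef
  have hNm : MeasurableSet N := measurableSet_le measurable_const hFm
  have hJm : MeasurableSet (Icc ℓ₁ ℓ₂) := measurableSet_Icc
  have hBad : volume.real (N ∩ Icc ℓ₁ ℓ₂) ≤ η * (ℓ₂ - ℓ₁) := by
    have hM := mul_meas_ge_le_integral_of_nonneg (μ := volume.restrict (Icc ℓ₁ ℓ₂)) (ae_of_all _ hFnn)
      hFint.restrict tF
    have hset : ∫ s in Icc ℓ₁ ℓ₂, hF s ≤ X := (setIntegral_le_integral hFint (ae_of_all _ hFnn)).trans hFtot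
    rw [measureReal_restrict_apply' hJm] at hM
    have hle : tF * volume.real ({s | tF ≤ hF s} ∩ Icc ℓ₁ ℓ₂) ≤ X := hM.trans hset
    have e1 : X = tF * (η * (ℓ₂ - ℓ₁)) := by rw [htF]; field_simp
    rw [e1] at hle
    exact le_of_mul_le_mul_left hle htFpos
  refine ⟨N, ?_, ?_⟩
  · have hfin : volume (N ∩ Icc ℓ₁ ℓ₂) ≠ ⊤ := measure_ne_top_of_subset inter_subset_right measure_Icc_lt_top.ne
    rw [← ENNReal.ofReal_toReal hfin]
    exact ENNReal.ofReal_le_ofReal hBad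
  -- per good height: `2π(1−2δ)² A(s)² ≤ L · hGs s`
  have hsmall' : Real.sqrt (2 * tF / Real.pi) / r ≤ δ * (γ * ℓ₁) := by
    have : 2 * tF / Real.pi = 2 * (X / (η * (ℓ₂ - ℓ₁))) / Real.pi := by rw [htF]
    rw [this]; exact hsmall
  have hpt : ∀ s ∈ Icc ℓ₁ ℓ₂ \ N,
      2 * Real.pi * (1 - 2 * δ) ^ 2 * A s ^ 2 ≤ Real.log (G * r / (δ * (γ * ℓ₁))) * hGs s := by
    rintro s ⟨hs, hsN⟩
    have hsℓ : ℓ₁ ≤ s := hs.1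
    have hm₀ : 0 < γ * ℓ₁ := mul_pos hγ hℓ₁
    have hm₀m : γ * ℓ₁ ≤ A s := (mul_le_mul_of_nonneg_left hsℓ hγ.le).trans (hAs s hs)
    obtain ⟨y₁, hy₁e, hy₁n, hy₁V⟩ := hcross s hs
    set y₁' : EuclideanSpace ℝ (Fin 3) := Rot y₁ with hy₁'
    have hy₁'2 : y₁' 2 = s := by
      rw [← EuclideanSpace.inner_basisFun_real (x := y₁') (i := 2), ← he₂, hy₁', ← hRot, Rot.inner_map_map, hy₁e]
    have hy₁'n : ‖y₁'‖ ≤ ℓ₂ := by rw [hy₁', Rot.norm_map]; exact hy₁n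
    have hWy : A s ≤ ‖W y₁'‖ := by
      have h2 : W y₁' = V y₁ := by simp [hW, hy₁']
      rw [h2]; exact hy₁V
    have hfit : ‖y₁'‖ + r < R' := by linarith
    have hFs : ∫ a, (ball (0 : EuclideanSpace ℝ (Fin 3)) R').indicator (fun x => ‖W x‖ ^ 2) (plane (y₁' 2) a) ≤ tF := by
      rw [hy₁'2]; exact (not_le.1 hsN).le
    have hGsle : ∫ a, (ball (0 : EuclideanSpace ℝ (Fin 3)) R').indicator (fun x => ‖fderiv ℝ W x‖ ^ 2) (plane (y₁' 2) a)
        ≤ hGs s := by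
      rw [hy₁'2, hGs_eq s hsℓ]
    obtain ⟨-, hbound⟩ := slicewise_height_bound hWc hm₀ hm₀m hWy hr hfit hδ hδ2 hGW hFs hGsle hsmall'
    calc 2 * Real.pi * (1 - 2 * δ) ^ 2 * A s ^ 2 = 2 * Real.pi * ((1 - 2 * δ) * A s) ^ 2 := by ring
      _ ≤ Real.log (G * r / (δ * (γ * ℓ₁))) * hGs s := hbound
  -- the logarithm is nonnegative (one good height exists)
  have hSm : MeasurableSet (Icc ℓ₁ ℓ₂ \ N) := hJm.diff hNm
  have hJfin : volume (Icc ℓ₁ ℓ₂) ≠ ⊤ := measure_Icc_lt_top.ne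
  have hSvol : 0 < volume.real (Icc ℓ₁ ℓ₂ \ N) := by
    have hsplit := measureReal_inter_add_sdiff (μ := volume) (s := Icc ℓ₁ ℓ₂) (t := N) hNm hJfin
    rw [Real.volume_real_Icc_of_le hℓ.le, inter_comm] at hsplit
    nlinarith
  obtain ⟨s₀, hs₀⟩ : (Icc ℓ₁ ℓ₂ \ N).Nonempty := by
    by_contra hemp
    rw [Set.not_nonempty_iff_eq_empty] at hemp
    rw [hemp, measureReal_empty] at hSvol
    exact lt_irrefl _ hSvol
  have hL0 : 0 ≤ Real.log (G * r / (δ * (γ * ℓ₁))) := by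
    obtain ⟨y₁, hy₁e, hy₁n, hy₁V⟩ := hcross s₀ hs₀.1
    set y₁' : EuclideanSpace ℝ (Fin 3) := Rot y₁ with hy₁'
    have hm₀ : 0 < γ * ℓ₁ := mul_pos hγ hℓ₁
    have hm₀m : γ * ℓ₁ ≤ A s₀ := (mul_le_mul_of_nonneg_left hs₀.1.1 hγ.le).trans (hAs s₀ hs₀.1)
    have hy₁'2 : y₁' 2 = s₀ := by
      rw [← EuclideanSpace.inner_basisFun_real (x := y₁') (i := 2), ← he₂, hy₁', ← hRot, Rot.inner_map_map, hy₁e]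
    have hy₁'n : ‖y₁'‖ ≤ ℓ₂ := by rw [hy₁', Rot.norm_map]; exact hy₁n
    have hWy : A s₀ ≤ ‖W y₁'‖ := by
      have h2 : W y₁' = V y₁ := by simp [hW, hy₁']
      rw [h2]; exact hy₁V
    have hfit : ‖y₁'‖ + r < R' := by linarith
    have hFs : ∫ a, (ball (0 : EuclideanSpace ℝ (Fin 3)) R').indicator (fun x => ‖W x‖ ^ 2) (plane (y₁' 2) a) ≤ tF := by
      rw [hy₁'2]; exact (not_le.1 hs₀.2).le
    obtain ⟨hpre, -⟩ := slicewise_height_bound hWc hm₀ hm₀m hWy hr hfit hδ hδ2 hGW hFs le_rfl hsmall'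
    refine Real.log_nonneg ?_
    rw [le_div_iff₀ (by positivity)]
    have := (div_le_iff₀ hr).1 hpre
    linarith
  -- integrate over the good heights
  have hmono : ∫ s in Icc ℓ₁ ℓ₂ \ N, 2 * Real.pi * (1 - 2 * δ) ^ 2 * A s ^ 2 ≤
      ∫ s in Icc ℓ₁ ℓ₂ \ N, Real.log (G * r / (δ * (γ * ℓ₁))) * hGs s := by
    refine integral_mono_of_nonneg (ae_of_all _ fun s => by positivity) ((hGsint.const_mul _).integrableOn) ?_
    filter_upwards [ae_restrict_mem hSm] with s hs
    exact hpt s hs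
  have hconst : ∫ s in Icc ℓ₁ ℓ₂ \ N, 2 * Real.pi * (1 - 2 * δ) ^ 2 * A s ^ 2 =
      2 * Real.pi * (1 - 2 * δ) ^ 2 * ∫ s in Icc ℓ₁ ℓ₂ \ N, A s ^ 2 := integral_const_mul _ _
  have hright : ∫ s in Icc ℓ₁ ℓ₂ \ N, Real.log (G * r / (δ * (γ * ℓ₁))) * hGs s ≤
      Real.log (G * r / (δ * (γ * ℓ₁))) * S := by
    rw [integral_const_mul]
    refine mul_le_mul_of_nonneg_left ?_ hL0
    exact (setIntegral_le_integral hGsint (ae_of_all _ hGsnn)).trans hGstot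
  rw [← hconst]
  exact hmono.trans hright

end Summit.NavierStokesRegularity.NavierStokesRegularity.Theorems.PowerGaugeEulerLiouville.Condenser

end
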